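import Summits.ValiantsHypothesis.ValiantsHypothesis.Theorems.KPlusLogSqLawTropicalBBoardLaw

/-!
# Route «KPlusLogSqLaw», crux `TropicalB` (stmt-ValiantsHypothesis-19771) — NO LOW RESET:
# while the cells of the complementary pair stand still, the count of the upper low class can only rise

HONEST FRAMING.  Second sequel of `…TropicalBBoardLaw` (seat val-sym-trop-p3 g18, cell `pub-symmetroid`, 2026-08-29; `--supports
stmt-ValiantsHypothesis-19771 --as helper`).  A STRUCTURE law for dominant chains of an ARBITRARY design (any format, exponents, valuations,
support), in the currency of the cell's `K = 4` fork; it is the kernel form of the obstruction that kills «fixed high cells + low odometer by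
re-matching» architectures (seat memo HOME/val-sym-trop-p3/g18/K4-TELESCOPE-g18.md §3.4 (i)).  Nothing here bounds `TropicalB` in its window;
nothing bears on `WeakLifting`, DoorA26 / DoorA34, `MatrixDescartes` (stmt-ValiantsHypothesis-18050) or VP ≠ VNP.

* `BoardLaw.sl_eq_of_two` — the `J`-slope of a term with classes in `{a,b}` on `J` is `(#J − x)·d a + x·d b`, `x` = number of `b`-columns.
* `BoardLaw.card_low_lt_of_agree_off` — **NO LOW RESET**: if two terms `p j` (earlier), `p k` (later) of a dominant chain agree (cell and
  class) off a column set `O` on which both carry only the classes `a, b` with `d a < d b`, then the number of `b`-columns in `O` strictly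
  RISES from `p j` to `p k` (restricted-optimum comparison `IntervalOpt.sl_lt_of_inOpt` on `O`; the images of `O` agree because the terms
  agree off `O`, `BoardLaw.image_compl_perm`; the restrictions differ because chain terms are distinct, `injective_of_chainD`).
* `BoardLaw.card_b_lt_of_agree_high` — **FIXED HIGH CELLS ⇒ THE LOW COUNT ONLY RISES**: if `p j`, `p k` (`j < k`) agree at every column at
  which either carries a class outside `{a,b}`, then `p k` has strictly more `b`-cells than `p j`.  So a later level of an odometer can never
  restart its `{a,b}`-digit from a lower value unless, in between, a cell of the complementary classes moved, appeared or disappeared at a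
  column of the exchange — every «reset» is paid for by motion of the other pair (cf. the board-change law of `…TropicalBBoardLawPairs`).

READING (located, nothing claimed): this is why SHIFT-THREE resets on FRESH cells (the next rotation) and why the mountain's high cell slides at
every step; for the fork it says the third digit's resets are high-cell moves, `Ω(m²)` of them in a cubic family.  [this cell]
-/

set_option linter.dupNamespace false
set_option autoImplicit false

namespace Summit.ValiantsHypothesis.ValiantsHypothesis.Theorems.KPlusLogSqLaw

open Summit.ValiantsHypothesis.ValiantsHypothesis.Theorems.MatrixDescartes.Negative
open Summit.ValiantsHypothesis.ValiantsHypothesis.Theorems.LacunarySymmetroidMatrixDescartes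
open scoped BigOperators
open Finset

namespace BoardLaw

variable {m K : ℕ}

/-- the `J`-slope of a term whose classes on `J` lie in `{a, b}`, written with the number of `b`-columns. [folklore] -/
theorem sl_eq_of_two (d : Fin K → ℕ) (a b : Fin K) (J : Finset (Fin m))
    (q : Equiv.Perm (Fin m) × (Fin m → Fin K)) (h : ∀ i ∈ J, q.2 i = a ∨ q.2 i = b) :
    IntervalOpt.sl d J q = ((J.card : ℤ) - (J.filter fun i => q.2 i = b).card) * d a +
      ((J.filter fun i => q.2 i = b).card : ℤ) * d b := by
  classical
  unfold IntervalOpt.sl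
  have hsplit := sum_filter_add_sum_filter_not J (fun i => q.2 i = b) (fun i => (d (q.2 i) : ℤ))
  have h1 : ∑ i ∈ J.filter (fun i => q.2 i = b), (d (q.2 i) : ℤ) = ((J.filter fun i => q.2 i = b).card : ℤ) * d b := by
    rw [sum_congr rfl (fun i hi => by rw [(mem_filter.1 hi).2] : ∀ i ∈ J.filter (fun i => q.2 i = b), (d (q.2 i) : ℤ) = d b),
      sum_const, nsmul_eq_mul]
  have h2 : ∑ i ∈ J.filter (fun i => ¬ q.2 i = b), (d (q.2 i) : ℤ) = ((J.filter fun i => ¬ q.2 i = b).card : ℤ) * d a := by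
    rw [sum_congr rfl (fun i hi => ?_ : ∀ i ∈ J.filter (fun i => ¬ q.2 i = b), (d (q.2 i) : ℤ) = d a), sum_const, nsmul_eq_mul]
    obtain ⟨hiJ, hib⟩ := mem_filter.1 hi
    rcases h i hiJ with hq | hq
    · rw [hq]
    · exact absurd hq hib
  have hcard := card_filter_add_card_filter_not (s := J) (fun i => q.2 i = b)
  rw [← hsplit, h1, h2]
  have : ((J.filter fun i => ¬ q.2 i = b).card : ℤ) = (J.card : ℤ) - (J.filter fun i => q.2 i = b).card := by
    rw [← hcard]; push_cast; ring
  rw [this]; ring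

section Chain

variable (d : Fin K → ℕ) (v ε : Fin m → Fin m → Fin K → ℤ) {n : ℕ} (θ : Fin (n + 1) → ℤ)
  (p : Fin (n + 1) → Equiv.Perm (Fin m) × (Fin m → Fin K))

/-- **NO LOW RESET.**  Let two terms `p j` (earlier) and `p k` (later) of a dominant chain agree (cell and class) off a column set `O` on which
both carry only the classes `a, b` with `d a < d b`.  Then the number of `b`-columns in `O` strictly RISES from `p j` to `p k`: a later term can
never return to fewer upper-low cells on a region that it shares, up to low re-matching, with an earlier term.  (Restricted-optimum comparison
`IntervalOpt.sl_lt_of_inOpt` on `O`: the images of `O` agree because the terms agree off `O`.) [this cell] -/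
theorem card_low_lt_of_agree_off (hθ : StrictMono θ) (hdom : ∀ k, IsDominant d v ε (θ k) (p k))
    (hne : ∀ k : Fin n, p k.castSucc ≠ p k.succ) {j k : Fin (n + 1)} (hjk : j < k) {a b : Fin K} (hab : d a < d b)
    (O : Finset (Fin m)) (hagree : ∀ i, i ∉ O → (p j).1 i = (p k).1 i ∧ (p j).2 i = (p k).2 i)
    (hlowj : ∀ i ∈ O, (p j).2 i = a ∨ (p j).2 i = b) (hlowk : ∀ i ∈ O, (p k).2 i = a ∨ (p k).2 i = b) :
    (O.filter fun i => (p j).2 i = b).card < (O.filter fun i => (p k).2 i = b).card := by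
  classical
  -- images of `O` agree (complements agree pointwise)
  have hC : Oᶜ.image (p j).1 = Oᶜ.image (p k).1 :=
    image_congr fun i hi => (hagree i (mem_compl.1 (mem_coe.1 hi))).1
  have himg : O.image (p j).1 = O.image (p k).1 := by
    have h1 := image_compl_perm (p j).1 O
    have h2 := image_compl_perm (p k).1 O
    have : (O.image (p j).1)ᶜ = (O.image (p k).1)ᶜ := by rw [← h1, ← h2, hC]
    exact compl_injective this
  -- the restrictions to `O` differ (else the terms coincide)
  have hrs : IntervalOpt.restr O (p j) ≠ IntervalOpt.restr O (p k) := by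
    intro h
    have := IntervalOpt.eq_of_restr_eq_of_agreeOut h (fun i hi => hagree i hi)
    exact (injective_of_chainD d v ε θ p hθ hdom hne).ne (ne_of_lt hjk) this
  have hopt : ∀ k', IntervalOpt.InOpt d v ε O (θ k') (p k') := fun k' =>
    IntervalOpt.inOpt_mono (subset_univ O) (IntervalOpt.inOpt_univ_of_isDominant (hdom k'))
  have hsl := IntervalOpt.sl_lt_of_inOpt (hopt j) (hopt k) himg (hθ hjk) hrs
  rw [sl_eq_of_two d a b O (p j) hlowj, sl_eq_of_two d a b O (p k) hlowk] at hsl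
  have hxj : ((O.filter fun i => (p j).2 i = b).card : ℤ) ≤ O.card := by exact_mod_cast card_le_card (filter_subset _ _)
  have hxk : ((O.filter fun i => (p k).2 i = b).card : ℤ) ≤ O.card := by exact_mod_cast card_le_card (filter_subset _ _)
  have hda : (d a : ℤ) < d b := by exact_mod_cast hab
  by_contra hcon
  push Not at hcon
  have hcon' : ((O.filter fun i => (p k).2 i = b).card : ℤ) ≤ (O.filter fun i => (p j).2 i = b).card := by exact_mod_cast hcon
  nlinarith

/-- **FIXED HIGH CELLS ⇒ THE LOW COUNT ONLY RISES.**  If two terms `p j` (earlier), `p k` (later) of a dominant chain (`d a < d b`) agree at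
every column at which either of them carries a class outside `{a,b}` («the high cells stand still»), then `p k` has strictly MORE `b`-cells
than `p j`.  So while the cells of the complementary pair stand still, the `{a,b}`-digit cannot be reset: a subsequence of the chain
with a fixed high configuration has strictly increasing `b`-count (at most `m + 1` terms, cf. the board law). [this cell] -/
theorem card_b_lt_of_agree_high (hθ : StrictMono θ) (hdom : ∀ k, IsDominant d v ε (θ k) (p k))
    (hne : ∀ k : Fin n, p k.castSucc ≠ p k.succ) {j k : Fin (n + 1)} (hjk : j < k) {a b : Fin K} (hab : d a < d b)
    (h : ∀ i, (¬ ((p j).2 i = a ∨ (p j).2 i = b) ∨ ¬ ((p k).2 i = a ∨ (p k).2 i = b)) →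
      (p j).1 i = (p k).1 i ∧ (p j).2 i = (p k).2 i) :
    (univ.filter fun i => (p j).2 i = b).card < (univ.filter fun i => (p k).2 i = b).card := by
  classical
  set O := univ.filter fun i => ((p j).2 i = a ∨ (p j).2 i = b) ∧ ((p k).2 i = a ∨ (p k).2 i = b) with hO
  have hagree : ∀ i, i ∉ O → (p j).1 i = (p k).1 i ∧ (p j).2 i = (p k).2 i := by
    intro i hi
    apply h i
    by_contra hh
    push Not at hh
    exact hi (mem_filter.2 ⟨mem_univ _, hh.1, hh.2⟩)
  have hlowj : ∀ i ∈ O, (p j).2 i = a ∨ (p j).2 i = b := fun i hi => (mem_filter.1 hi).2.1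
  have hlowk : ∀ i ∈ O, (p k).2 i = a ∨ (p k).2 i = b := fun i hi => (mem_filter.1 hi).2.2
  have hlt := card_low_lt_of_agree_off d v ε θ p hθ hdom hne hjk hab O hagree hlowj hlowk
  -- the `b`-columns outside `O` are the same for both terms
  have hout : ∀ i, i ∉ O → ((p j).2 i = b ↔ (p k).2 i = b) := fun i hi => by rw [(hagree i hi).2]
  have hsplit : ∀ q : Equiv.Perm (Fin m) × (Fin m → Fin K),
      (univ.filter fun i => q.2 i = b).card = (O.filter fun i => q.2 i = b).card + (Oᶜ.filter fun i => q.2 i = b).card := by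
    intro q
    rw [← card_union_of_disjoint (disjoint_filter_filter (disjoint_compl_right (a := O)))]
    congr 1
    ext i
    simp only [mem_filter, mem_univ, true_and, mem_union, mem_compl]
    tauto
  have hO' : (Oᶜ.filter fun i => (p j).2 i = b) = (Oᶜ.filter fun i => (p k).2 i = b) :=
    filter_congr fun i hi => hout i (mem_compl.1 hi)
  rw [hsplit (p j), hsplit (p k), hO']
  omega

end Chain

end BoardLaw

end Summit.ValiantsHypothesis.ValiantsHypothesis.Theorems.KPlusLogSqLaw
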